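import Summits.QuantumFields.YangMills.Theorems.ColdStartUniversalityLatticeLangevinPointwiseMixingUniform
import Summits.QuantumFields.YangMills.Theorems.ColdStartUniversalityLatticeLangevinBlockLoopStringMixing
import HarnessLib

/-!
# Route `ColdStartUniversality` (fixed-cut-off package, Bakry–Émery side, GRADIENT half): EVERY-START EXPONENTIAL MIXING OF BLOCK-AVERAGED
# LOOP STRINGS `∏_k W̄_(B,k)` — the crux's observable shape — with constant `4√6·π·Σ_k(R_k+T_k)·√(#sites/#B)`

Helper file (seat `ym-line-csu-p1`, g29; `--supports stmt-QuantumFields-24809`).  The every-start mixing theorem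
`wilson_pointwise_mixing_of_carre_uniform` (gradient bound + oscillation–carré du champ lemma + invariance of `μ_(β')`) read on products of
block-averaged rectangular Wilson loops `∏_k W̄_(B,k)`, `W̄_(B,k) = (#B)⁻¹ Σ_(x∈B) W_(R_k×T_k)(x; i_k, j_k)`, through their `C⁵` coordinate
functionals (`blockLoopAverage_coords_eq`, `contDiff_blockLoopAverage`) and the carré du champ bound `Γ^A(∏_k W̄_(B,k)) ≤ 32(Σ_k(R_k+T_k))²/#B`
(`wilson_blockLoopString_carre_le`); with `#E = 3·#sites`, `π√#E·σ = 4√6·π·Σ_k(R_k+T_k)·√(#sites/#B)` — VOLUME-FREE for blocks occupying a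
fixed fraction of the torus (e.g. `B` = all sites), with NO burn-in time and NO `ρ^(-1/2)` factor (compare the entropy route
`wilson_coldStart_blockLoopString_le_blocks`):
* ★★★ `wilson_blockLoopString_pointwise_mixing_uniform` — kernel level, every `t ≥ 0`, EVERY start `x`;
* ★★★ `wilson_solution_blockLoopString_pointwise_mixing_uniform` — along every strong SZZ solution from a deterministic start;
* ★★ `blockLoopString_pointwiseMixing_fixedCutoff_window` — at the route's cut-offs inside the window `γε_K > 6`.
THEOREMS ONLY, no definition, no sorry.  [cite: BakryGentilLedoux2014, Thm 3.3.18; ShenZhuZhu2022 §4 Cor. 4.7].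
HONEST FRAMING: fixed cut-off and FIXED coupling `|β'| < 1/12`; uniform in `L`, the start and the time only; the route's scaling
`β'_K = (γε_K)⁻¹/2 → ∞` leaves the window, so nothing here is `K`-uniform; `UniformColdStartMixing` (stmt-24809, aside) is NOT restated
or weakened, and the Yang–Mills mass gap is NOT proved.
-/

set_option autoImplicit false

noncomputable section

namespace Summit.QuantumFields.YangMills.Theorems.ColdStartUniversality

open MeasureTheory ProbabilityTheory Matrix Complex Finset Filter Set Metric
open scoped ComplexConjugate BigOperators Matrix NNReal ENNReal Topology
open Literature.Probability.Process Literature.MathematicalPhysics.QuantumFieldTheory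
open Literature.MathematicalPhysics.QuantumFieldTheory.Balaban1983to89
open Literature.MathematicalPhysics.QuantumLattice (fundamentalRep fundamentalLatticeRep continuous_fundamentalRep fundamentalRep_apply)

variable {L : ℕ} [NeZero L]

/-- ★★★ **Every-start mixing of block-averaged loop strings.**  At `|β'| < 1/12`, for every torus size `L`, every nonempty block `B`, loop
data `(i_k, j_k, R_k, T_k)_(k<m)`, every Markov kernel family `κ` realising the SZZ solutions, every `t ≥ 0` and EVERY configuration `x`:
`|κ_t(∏_k W̄_(B,k))(x) − ∫ ∏_k W̄_(B,k) dμ_(β')| ≤ 4√6·π·Σ_k(R_k+T_k)·√(#sites/#B)·e^(−(1−12|β'|)t)`.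
[cite: BakryGentilLedoux2014, Thm 3.3.18; ShenZhuZhu2022 §4 Cor. 4.7] -/
theorem wilson_blockLoopString_pointwise_mixing_uniform (L : ℕ) [NeZero L] (β' : ℝ) (hβ : |β'| < 1 / 12)
    (m : ℕ) (i j : Fin m → Fin 3) (R T : Fin m → ℕ) (B : Finset (Site 3 L)) (hB : B.Nonempty)
    (κ : ℝ≥0 → Kernel (GaugeConfig 3 L (Matrix.specialUnitaryGroup (Fin 2) ℂ))
      (GaugeConfig 3 L (Matrix.specialUnitaryGroup (Fin 2) ℂ))) [∀ t, IsMarkovKernel (κ t)]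
    (hreal : ∀ (t : ℝ≥0) (x : GaugeConfig 3 L (Matrix.specialUnitaryGroup (Fin 2) ℂ))
        (Ω : Type) [MeasurableSpace Ω] (P : Measure Ω) [IsProbabilityMeasure P]
        (W : ℝ≥0 → Ω → (Edge 3 L × NoiseIdx 2 → ℝ)) (hW : IsFlatBrownian W P)
        (U : ℝ≥0 → Ω → GaugeConfig 3 L (Matrix.specialUnitaryGroup (Fin 2) ℂ)),
        (∀ ω, U 0 ω = x) →
        (latticeLangevinDynamics (fundamentalLatticeRep 2) β').IsSolution (fundamentalRep (Fin 2))
          hW.natFiltration P W U →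
        κ t x = P.map (U t))
    (t : ℝ≥0) (x : (GaugeConfig 3 L (Matrix.specialUnitaryGroup (Fin 2) ℂ))) :
    |∫ y, (∏ k : Fin m, (((B.card : ℝ))⁻¹ * ∑ x ∈ B, wilsonLoop (fundamentalRep (Fin 2)) x (i k) (j k) (R k) (T k) y)) ∂(κ t x) - ∫ y, (∏ k : Fin m, (((B.card : ℝ))⁻¹ * ∑ x ∈ B, wilsonLoop (fundamentalRep (Fin 2)) x (i k) (j k) (R k) (T k) y)) ∂(wilsonMeasure (d := 3) (L := L) (fundamentalRep (Fin 2)) β')| ≤ 4 * Real.sqrt 6 * Real.pi * (∑ k : Fin m, ((R k : ℝ) + T k)) * Real.sqrt ((Fintype.card (Site 3 L) : ℝ) / (B.card : ℝ)) * Real.exp (-((1 - 12 * |β'|) * (t : ℝ))) := by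
  classical
  haveI := secondCountableTopology_su2
  haveI := borelSpace_config L
  have hS : (0 : ℝ) < (B.card : ℝ) := by exact_mod_cast hB.card_pos
  have hSum : (0 : ℝ) ≤ (∑ k : Fin m, ((R k : ℝ) + T k)) := Finset.sum_nonneg fun k _ => by positivity
  set co : (GaugeConfig 3 L (Matrix.specialUnitaryGroup (Fin 2) ℂ)) → (Edge 3 L × Fin 2 × Fin 2 × Bool → ℝ) := (fun (V : GaugeConfig 3 L (Matrix.specialUnitaryGroup (Fin 2) ℂ)) (q : Edge 3 L × Fin (fundamentalLatticeRep 2).N × Fin (fundamentalLatticeRep 2).N × Bool) => (fun z : ℂ => if q.2.2.2 then z.im else z.re) ((fundamentalRep (Fin 2) (V q.1) : Matrix (Fin 2) (Fin 2) ℂ) q.2.1 q.2.2.1)) with hco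
  set F : Fin m → (Edge 3 L × Fin 2 × Fin 2 × Bool → ℝ) → ℝ := fun k => (fun y : (Edge 3 L × Fin 2 × Fin 2 × Bool → ℝ) => (2 * (B.card : ℝ))⁻¹ * ∑ x ∈ B, ((((((List.range (R k)).map (fun m : ℕ => ((Pi.single (i k) ((m : ℕ) : ZMod L) : Site 3 L), (i k), false)) ++ (List.range (T k)).map (fun m : ℕ => ((Pi.single (i k) (((R k) : ℕ) : ZMod L) : Site 3 L) + (Pi.single (j k) ((m : ℕ) : ZMod L) : Site 3 L), (j k), false)) ++ ((List.range (R k)).map (fun m : ℕ => ((Pi.single (j k) (((T k) : ℕ) : ZMod L) : Site 3 L) + (Pi.single (i k) ((m : ℕ) : ZMod L) : Site 3 L), (i k), true))).reverse ++ ((List.range (T k)).map (fun m : ℕ => ((Pi.single (j k) ((m : ℕ) : ZMod L) : Site 3 L), (j k), true))).reverse).map (fun q : Site 3 L × Fin 3 × Bool => ((x + q.1, q.2.1), q.2.2))).map (fun a : Edge 3 L × Bool => if a.2 then ((fun (ee : Edge 3 L) => Matrix.of fun (i' j' : Fin 2) => ((y (ee, i', j', false) : ℝ) : ℂ) + ((y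 (ee, i', j', true) : ℝ) : ℂ) * Complex.I) a.1)ᴴ else (fun (ee : Edge 3 L) => Matrix.of fun (i' j' : Fin 2) => ((y (ee, i', j', false) : ℝ) : ℂ) + ((y (ee, i', j', true) : ℝ) : ℂ) * Complex.I) a.1)).prod)).trace.re) with hFdef
  have hfC : ContDiff ℝ 5 (fun y => ∏ k : Fin m, F k y) := contDiff_prod (fun k _ => contDiff_blockLoopAverage _ _ B)
  have hval : ∀ (k) (V : (GaugeConfig 3 L (Matrix.specialUnitaryGroup (Fin 2) ℂ))), F k (co V) = (((B.card : ℝ))⁻¹ * ∑ x ∈ B, wilsonLoop (fundamentalRep (Fin 2)) x (i k) (j k) (R k) (T k) V) :=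
    fun k V => blockLoopAverage_coords_eq V (i k) (j k) (R k) (T k) B hB
  have hvalP : ∀ V : (GaugeConfig 3 L (Matrix.specialUnitaryGroup (Fin 2) ℂ)), (∏ k : Fin m, F k (co V)) = (∏ k : Fin m, (((B.card : ℝ))⁻¹ * ∑ x ∈ B, wilsonLoop (fundamentalRep (Fin 2)) x (i k) (j k) (R k) (T k) V)) :=
    fun V => Finset.prod_congr rfl fun k _ => hval k V
  -- `Γ^A(∏ F) ≤ C = σ²` with `σ = √C`
  have hC0 : 0 ≤ (32 * (∑ k : Fin m, ((R k : ℝ) + T k)) ^ 2 / (B.card : ℝ)) := div_nonneg (mul_nonneg (by norm_num) (sq_nonneg _)) hS.le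
  have hσ : 0 ≤ Real.sqrt (32 * (∑ k : Fin m, ((R k : ℝ) + T k)) ^ 2 / (B.card : ℝ)) := Real.sqrt_nonneg _
  have hΓ := wilson_blockLoopString_carre_le L β' m i j R T B hB
  have h := wilson_pointwise_mixing_of_carre_uniform L β' hβ κ hreal hfC hσ t (fun y => by
    rw [Real.sq_sqrt hC0]
    exact hΓ y) x
  -- the constant: `√#E · √C = 4√6 · Σ_k(R_k+T_k) · √(#sites/#B)`
  have hEC : (Fintype.card (Edge 3 L) : ℝ) * (32 * (∑ k : Fin m, ((R k : ℝ) + T k)) ^ 2 / (B.card : ℝ)) = (4 * Real.sqrt 6 * (∑ k : Fin m, ((R k : ℝ) + T k)) * Real.sqrt ((Fintype.card (Site 3 L) : ℝ) / (B.card : ℝ))) ^ 2 := by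
    rw [card_edge_eq_three_mul_card_site, mul_pow, mul_pow, mul_pow, Real.sq_sqrt (show (0:ℝ) ≤ 6 by norm_num),
      Real.sq_sqrt (div_nonneg (Nat.cast_nonneg _) hS.le)]
    ring
  have hroot : Real.sqrt (Fintype.card (Edge 3 L) : ℝ) * Real.sqrt (32 * (∑ k : Fin m, ((R k : ℝ) + T k)) ^ 2 / (B.card : ℝ)) = 4 * Real.sqrt 6 * (∑ k : Fin m, ((R k : ℝ) + T k)) * Real.sqrt ((Fintype.card (Site 3 L) : ℝ) / (B.card : ℝ)) := by
    rw [← Real.sqrt_mul (Nat.cast_nonneg _), hEC, Real.sqrt_sq (mul_nonneg (mul_nonneg (mul_nonneg (by norm_num) (Real.sqrt_nonneg _)) hSum) (Real.sqrt_nonneg _))]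
  have hfin : Real.pi * Real.sqrt (Fintype.card (Edge 3 L) : ℝ) * (Real.exp (-((1 - 12 * |β'|) * (t : ℝ))) * Real.sqrt (32 * (∑ k : Fin m, ((R k : ℝ) + T k)) ^ 2 / (B.card : ℝ))) = 4 * Real.sqrt 6 * Real.pi * (∑ k : Fin m, ((R k : ℝ) + T k)) * Real.sqrt ((Fintype.card (Site 3 L) : ℝ) / (B.card : ℝ)) * Real.exp (-((1 - 12 * |β'|) * (t : ℝ))) := by
    calc Real.pi * Real.sqrt (Fintype.card (Edge 3 L) : ℝ) * (Real.exp (-((1 - 12 * |β'|) * (t : ℝ))) * Real.sqrt (32 * (∑ k : Fin m, ((R k : ℝ) + T k)) ^ 2 / (B.card : ℝ)))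
        = Real.pi * (Real.sqrt (Fintype.card (Edge 3 L) : ℝ) * Real.sqrt (32 * (∑ k : Fin m, ((R k : ℝ) + T k)) ^ 2 / (B.card : ℝ))) * Real.exp (-((1 - 12 * |β'|) * (t : ℝ))) := by ring
      _ = 4 * Real.sqrt 6 * Real.pi * (∑ k : Fin m, ((R k : ℝ) + T k)) * Real.sqrt ((Fintype.card (Site 3 L) : ℝ) / (B.card : ℝ)) * Real.exp (-((1 - 12 * |β'|) * (t : ℝ))) := by rw [hroot]; ring
  rw [hfin] at h
  rw [show (fun y : (GaugeConfig 3 L (Matrix.specialUnitaryGroup (Fin 2) ℂ)) => (∏ k : Fin m, (((B.card : ℝ))⁻¹ * ∑ x ∈ B, wilsonLoop (fundamentalRep (Fin 2)) x (i k) (j k) (R k) (T k) y))) = fun y => ∏ k : Fin m, F k (co y) from funext fun y => (hvalP y).symm]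
  exact h

/-- ★★★ **Every-start mixing of block-averaged loop strings along EVERY SZZ solution.**  At `|β'| < 1/12`: for every `L`, nonempty block
`B`, loop data, every filtered probability space carrying a flat Brownian driver, every strong solution `U` of the SZZ Langevin SDE from a
deterministic start `U_0 ≡ x₀` (e.g. the COLD start) and every `t ≥ 0`:
`|E[∏_k W̄_(B,k)(U_t)] − ∫ ∏_k W̄_(B,k) dμ_(β')| ≤ 4√6·π·Σ_k(R_k+T_k)·√(#sites/#B)·e^(−(1−12|β'|)t)` — for `B` the whole torus the constant is
`4√6·π·Σ_k(R_k+T_k)`, volume-free, with no burn-in. [cite: BakryGentilLedoux2014, Thm 3.3.18; ShenZhuZhu2022 §4 Cor. 4.7] -/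
theorem wilson_solution_blockLoopString_pointwise_mixing_uniform (L : ℕ) [NeZero L] (β' : ℝ) (hβ : |β'| < 1 / 12)
    (m : ℕ) (i j : Fin m → Fin 3) (R T : Fin m → ℕ) (B : Finset (Site 3 L)) (hB : B.Nonempty)
    (t : ℝ≥0) (x₀ : (GaugeConfig 3 L (Matrix.specialUnitaryGroup (Fin 2) ℂ)))
    (Ω : Type) [MeasurableSpace Ω] (P : Measure Ω) [IsProbabilityMeasure P]
    (W : ℝ≥0 → Ω → (Edge 3 L × NoiseIdx 2 → ℝ)) (hW : IsFlatBrownian W P)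
    (U : ℝ≥0 → Ω → (GaugeConfig 3 L (Matrix.specialUnitaryGroup (Fin 2) ℂ))) (hU0 : ∀ ω, U 0 ω = x₀)
    (hU : (latticeLangevinDynamics (fundamentalLatticeRep 2) β').IsSolution (fundamentalRep (Fin 2)) hW.natFiltration P W U) :
    |∫ ω, (∏ k : Fin m, (((B.card : ℝ))⁻¹ * ∑ x ∈ B, wilsonLoop (fundamentalRep (Fin 2)) x (i k) (j k) (R k) (T k) (U t ω))) ∂P - ∫ y, (∏ k : Fin m, (((B.card : ℝ))⁻¹ * ∑ x ∈ B, wilsonLoop (fundamentalRep (Fin 2)) x (i k) (j k) (R k) (T k) y)) ∂(wilsonMeasure (d := 3) (L := L) (fundamentalRep (Fin 2)) β')| ≤ 4 * Real.sqrt 6 * Real.pi * (∑ k : Fin m, ((R k : ℝ) + T k)) * Real.sqrt ((Fintype.card (Site 3 L) : ℝ) / (B.card : ℝ)) * Real.exp (-((1 - 12 * |β'|) * (t : ℝ))) := by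
  classical
  haveI := secondCountableTopology_su2
  haveI := borelSpace_config L
  obtain ⟨κ, hκ, -, hreal⟩ := exists_transitionKernel L β'
  haveI := hκ
  have h := wilson_blockLoopString_pointwise_mixing_uniform L β' hβ m i j R T B hB κ hreal t x₀
  have hlaw : κ t x₀ = P.map (U t) := hreal t x₀ Ω P W hW U hU0 hU
  have hmU : Measurable (U t) := (hU.adapted t).mono (hW.natFiltration.le t) le_rfl
  set co : (GaugeConfig 3 L (Matrix.specialUnitaryGroup (Fin 2) ℂ)) → (Edge 3 L × Fin 2 × Fin 2 × Bool → ℝ) := (fun (V : GaugeConfig 3 L (Matrix.specialUnitaryGroup (Fin 2) ℂ)) (q : Edge 3 L × Fin (fundamentalLatticeRep 2).N × Fin (fundamentalLatticeRep 2).N × Bool) => (fun z : ℂ => if q.2.2.2 then z.im else z.re) ((fundamentalRep (Fin 2) (V q.1) : Matrix (Fin 2) (Fin 2) ℂ) q.2.1 q.2.2.1)) with hco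
  set F : Fin m → (Edge 3 L × Fin 2 × Fin 2 × Bool → ℝ) → ℝ := fun k => (fun y : (Edge 3 L × Fin 2 × Fin 2 × Bool → ℝ) => (2 * (B.card : ℝ))⁻¹ * ∑ x ∈ B, ((((((List.range (R k)).map (fun m : ℕ => ((Pi.single (i k) ((m : ℕ) : ZMod L) : Site 3 L), (i k), false)) ++ (List.range (T k)).map (fun m : ℕ => ((Pi.single (i k) (((R k) : ℕ) : ZMod L) : Site 3 L) + (Pi.single (j k) ((m : ℕ) : ZMod L) : Site 3 L), (j k), false)) ++ ((List.range (R k)).map (fun m : ℕ => ((Pi.single (j k) (((T k) : ℕ) : ZMod L) : Site 3 L) + (Pi.single (i k) ((m : ℕ) : ZMod L) : Site 3 L), (i k), true))).reverse ++ ((List.range (T k)).map (fun m : ℕ => ((Pi.single (j k) ((m : ℕ) : ZMod L) : Site 3 L), (j k), true))).reverse).map (fun q : Site 3 L × Fin 3 × Bool => ((x + q.1, q.2.1), q.2.2))).map (fun a : Edge 3 L × Bool => if a.2 then ((fun (ee : Edge 3 L) => Matrix.of fun (i' j' : Fin 2) => ((y (ee, i', j', false) : ℝ) : ℂ) + ((y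 (ee, i', j', true) : ℝ) : ℂ) * Complex.I) a.1)ᴴ else (fun (ee : Edge 3 L) => Matrix.of fun (i' j' : Fin 2) => ((y (ee, i', j', false) : ℝ) : ℂ) + ((y (ee, i', j', true) : ℝ) : ℂ) * Complex.I) a.1)).prod)).trace.re) with hFdef
  have hfC : ContDiff ℝ 5 (fun y => ∏ k : Fin m, F k y) := contDiff_prod (fun k _ => contDiff_blockLoopAverage _ _ B)
  have hval : ∀ (k) (V : (GaugeConfig 3 L (Matrix.specialUnitaryGroup (Fin 2) ℂ))), F k (co V) = (((B.card : ℝ))⁻¹ * ∑ x ∈ B, wilsonLoop (fundamentalRep (Fin 2)) x (i k) (j k) (R k) (T k) V) :=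
    fun k V => blockLoopAverage_coords_eq V (i k) (j k) (R k) (T k) B hB
  have hvalP : ∀ V : (GaugeConfig 3 L (Matrix.specialUnitaryGroup (Fin 2) ℂ)), (∏ k : Fin m, F k (co V)) = (∏ k : Fin m, (((B.card : ℝ))⁻¹ * ∑ x ∈ B, wilsonLoop (fundamentalRep (Fin 2)) x (i k) (j k) (R k) (T k) V)) :=
    fun V => Finset.prod_congr rfl fun k _ => hval k V
  have cY : Continuous fun y : (GaugeConfig 3 L (Matrix.specialUnitaryGroup (Fin 2) ℂ)) => (∏ k : Fin m, (((B.card : ℝ))⁻¹ * ∑ x ∈ B, wilsonLoop (fundamentalRep (Fin 2)) x (i k) (j k) (R k) (T k) y)) := by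
    rw [show (fun y : (GaugeConfig 3 L (Matrix.specialUnitaryGroup (Fin 2) ℂ)) => (∏ k : Fin m, (((B.card : ℝ))⁻¹ * ∑ x ∈ B, wilsonLoop (fundamentalRep (Fin 2)) x (i k) (j k) (R k) (T k) y))) = fun y => ∏ k : Fin m, F k (co y) from funext fun y => (hvalP y).symm]
    exact hfC.continuous.comp (continuous_coords (L := L))
  have e1 : ∫ y, (∏ k : Fin m, (((B.card : ℝ))⁻¹ * ∑ x ∈ B, wilsonLoop (fundamentalRep (Fin 2)) x (i k) (j k) (R k) (T k) y)) ∂(κ t x₀) = ∫ ω, (∏ k : Fin m, (((B.card : ℝ))⁻¹ * ∑ x ∈ B, wilsonLoop (fundamentalRep (Fin 2)) x (i k) (j k) (R k) (T k) (U t ω))) ∂P := by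
    rw [hlaw, integral_map hmU.aemeasurable cY.aestronglyMeasurable]
  rw [← e1]
  exact h

/-- ★★ **Every-start mixing of block-averaged loop strings at the route's cut-offs, inside the window `γε_K > 6`.**  For every cut-off `K`
with `6 < γε_K`, nonempty block `B`, loop data, every strong solution `U` of the SZZ SDE at `β'_K = (γε_K)⁻¹/2` on the `K`-th lattice from a
deterministic start (e.g. the cold start) and every lattice time `t`:
`|E[∏_k W̄_(B,k)(U_t)] − ∫ ∏_k W̄_(B,k) dμ_K| ≤ 4√6·π·Σ_k(R_k+T_k)·√(L_K³/#B)·e^(−(1 − 6/(γε_K))t)`.  (Window-bound, NOT `K`-uniform.)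
[cite: BakryGentilLedoux2014, Thm 3.3.18] -/
theorem blockLoopString_pointwiseMixing_fixedCutoff_window (F : T3ContinuumYM3Torus.T3Family) (γ : ℝ) (K : ℕ) (hK : 6 < γ * (F.P K).eps)
    (m : ℕ) (i j : Fin m → Fin 3) (R T : Fin m → ℕ) (B : Finset (Site 3 ((F.P K).sitesPerDir 0))) (hB : B.Nonempty)
    (t : ℝ≥0) (x₀ : GaugeConfig 3 ((F.P K).sitesPerDir 0) (Matrix.specialUnitaryGroup (Fin 2) ℂ))
    (Ω : Type) [MeasurableSpace Ω] (P : Measure Ω) [IsProbabilityMeasure P]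
    (W : ℝ≥0 → Ω → (Edge 3 ((F.P K).sitesPerDir 0) × NoiseIdx 2 → ℝ)) (hW : IsFlatBrownian W P)
    (U : ℝ≥0 → Ω → GaugeConfig 3 ((F.P K).sitesPerDir 0) (Matrix.specialUnitaryGroup (Fin 2) ℂ)) (hU0 : ∀ ω, U 0 ω = x₀)
    (hU : (latticeLangevinDynamics (fundamentalLatticeRep 2) ((γ * (F.P K).eps)⁻¹ / 2)).IsSolution (fundamentalRep (Fin 2)) hW.natFiltration P W U) :
    |∫ ω, (∏ k : Fin m, (((B.card : ℝ))⁻¹ * ∑ x ∈ B, wilsonLoop (fundamentalRep (Fin 2)) x (i k) (j k) (R k) (T k) (U t ω))) ∂P -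
        ∫ y, (∏ k : Fin m, (((B.card : ℝ))⁻¹ * ∑ x ∈ B, wilsonLoop (fundamentalRep (Fin 2)) x (i k) (j k) (R k) (T k) y)) ∂(wilsonMeasure (d := 3) (L := ((F.P K).sitesPerDir 0)) (fundamentalRep (Fin 2)) ((γ * (F.P K).eps)⁻¹ / 2))| ≤
      4 * Real.sqrt 6 * Real.pi * (∑ k : Fin m, ((R k : ℝ) + T k)) * Real.sqrt (((((((F.P K).sitesPerDir 0) : ℕ) : ℝ)) ^ 3) / (B.card : ℝ)) * Real.exp (-((1 - 6 / (γ * (F.P K).eps)) * (t : ℝ))) := by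
  obtain ⟨hβ, hrate⟩ := window_coupling_bounds F γ K hK
  have h := wilson_solution_blockLoopString_pointwise_mixing_uniform ((F.P K).sitesPerDir 0) ((γ * (F.P K).eps)⁻¹ / 2) hβ m i j R T B hB t x₀ Ω P W hW U hU0 hU
  rw [(card_site_plaquette_fixedCutoff F K).1, hrate] at h
  exact h

end Summit.QuantumFields.YangMills.Theorems.ColdStartUniversality
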